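import Summits.NavierStokesRegularity.NavierStokesRegularity.Theorems.OddMorawetzDefs
import Summits.NavierStokesRegularity.NavierStokesRegularity.Theorems.OddMorawetzLocal.Negative.OddMorawetzLocalSymmetryDefs

/-!
# Crux `OddMorawetz.MorawetzKillsTypeI` — stub `stub_cubicJetExpansion` (coordinates and weight blocks)

Two pieces of finite-dimensional linear algebra used by the isotropy cut of the crux
`Summit.NavierStokesRegularity.NavierStokesRegularity.Theses.OddMorawetz.MorawetzKillsTypeI`
(item `stmt-NavierStokesRegularity-1377`, line `registered`):

* (i) `CubicJetExpansion.coordinate_expansion`: every continuous `n`-multilinear map `Z : ℝ³ × ⋯ × ℝ³ → ℝ³` is the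
  finite combination `Z = ∑ᵢ ∑ⱼ (Z (e_{j 0}, …, e_{j (n-1)}))ᵢ • (h ↦ (∏ₛ h_s (j s)) eᵢ)` of the basis maps
  (expand each argument in the standard basis, multilinearity);
* (ii) `CubicJetExpansion.weight_blocks`: a continuous trilinear form `D` on 3-jets `z = (z₀, z₁, z₂, z₃)` which is
  symmetric under permutation of its arguments and scales with weight `k` on the diagonal under the jet
  dilation `(z₀, s z₁, s² z₂, s³ z₃)` (`s > 0`) is, on the diagonal, the sum of its weight-`k` blocks:
  for `k = 3` the blocks `(0,0,3) × 3`, `(0,1,2) × 6`, `(1,1,1) × 1`, for `k = 5` the blocks `(0,2,3) × 6`,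
  `(1,1,3) × 3`, `(1,2,2) × 3`.  Proof: polarisation (two symmetric trilinear forms which agree on the
  diagonal agree) upgrades the diagonal weight identity to `D (S x, S y, S w) = s ^ k D (x, y, w)`; on pure
  jets of orders `p, q, r` the dilation acts by `s ^ p, s ^ q, s ^ r`, so at `s = 2` the block vanishes unless
  `p + q + r = k`; finally `z = ∑ₚ (pure part of order p)` is expanded trilinearly and the surviving blocks
  are collected with the permutation symmetry.

The registered statement `stub_cubicJetExpansion` is the conjunction of (i) and (ii).  Mathlib only.
-/

noncomputable section

set_option linter.dupNamespace false

namespace Summit.NavierStokesRegularity.NavierStokesRegularity.Theorems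

open Summit.NavierStokesRegularity.NavierStokesRegularity.Theorems.OddMorawetz

namespace CubicJetExpansion

/-! ### Part (i): coordinates of a continuous multilinear map `ℝ³ × ⋯ × ℝ³ → ℝ³` -/

/-- **Coordinate expansion.** Every continuous `n`-multilinear map `Z : ℝ³ × ⋯ × ℝ³ → ℝ³` is the combination
of the basis maps `h ↦ (∏ₛ h_s (j s)) eᵢ` (`i : Fin 3`, `j : Fin n → Fin 3`) with coefficients
`(Z (e_{j 0}, …, e_{j (n-1)}))ᵢ`. -/
theorem coordinate_expansion (n : ℕ) (Z : E3 [×n]→L[ℝ] E3) :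
    Z = ∑ i : Fin 3, ∑ j : Fin n → Fin 3,
        (Z (fun s => EuclideanSpace.single (j s) (1 : ℝ)) i) •
          (ContinuousMultilinearMap.mkPiRing ℝ (Fin n) (EuclideanSpace.single i (1 : ℝ))).compContinuousLinearMap
            (fun s => EuclideanSpace.proj (j s)) := by
  have hexp : ∀ x : E3, x = ∑ j : Fin 3, x j • EuclideanSpace.single j (1 : ℝ) := by
    intro x
    conv_lhs => rw [← (EuclideanSpace.basisFun (Fin 3) ℝ).sum_repr x]
    simp
  ext h l
  have hh : h = fun s => ∑ j : Fin 3, h s j • EuclideanSpace.single j (1 : ℝ) := by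
    funext s; exact hexp (h s)
  conv_lhs => rw [hh]
  rw [ContinuousMultilinearMap.map_sum Z (fun s j => h s j • EuclideanSpace.single j (1 : ℝ))]
  simp only [ContinuousMultilinearMap.map_smul_univ, sum_apply, smul_apply,
    ContinuousMultilinearMap.compContinuousLinearMap_apply, ContinuousMultilinearMap.mkPiRing_apply,
    WithLp.ofLp_sum, Finset.sum_apply, PiLp.smul_apply, PiLp.single_apply, smul_eq_mul,
    EuclideanSpace.coe_proj]
  rw [Finset.sum_comm]
  simp only [mul_ite, mul_one, mul_zero, Finset.sum_ite_eq, Finset.mem_univ, if_true]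
  exact Finset.sum_congr rfl fun _ _ => mul_comm _ _

/-! ### Part (ii): weight blocks of a symmetric trilinear form on 3-jets -/

/-- `s • 0 = 0` on continuous multilinear maps `ℝ³ × ⋯ × ℝ³ → ℝ³` (a `simp` copy of `smul_zero` at the `SMul`
instance elaborated on these components of `Jet3`). -/
theorem smul_zero_cmm (n : ℕ) (s : ℝ) : s • (0 : E3 [×n]→L[ℝ] E3) = 0 := smul_zero (A := E3 [×n]→L[ℝ] E3) s

/-- The constant family `(v, v, v)` in `![…]` form. -/
theorem const_eq_vec3 (v : Jet3) : (fun _ : Fin 3 => v) = ![v, v, v] := by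
  funext i; fin_cases i <;> rfl

/-- Additivity of a trilinear form in the first slot. -/
theorem tri_add₁ (D : Jet3 [×3]→L[ℝ] ℝ) (x x' y w : Jet3) :
    D ![x + x', y, w] = D ![x, y, w] + D ![x', y, w] :=
  D.cons_add ![y, w] x x'

/-- Homogeneity of a trilinear form in the first slot. -/
theorem tri_smul₁ (D : Jet3 [×3]→L[ℝ] ℝ) (c : ℝ) (x y w : Jet3) :
    D ![c • x, y, w] = c * D ![x, y, w] :=
  D.cons_smul ![y, w] c x

section Symmetric

variable {D : Jet3 [×3]→L[ℝ] ℝ} (hsym : ∀ (x : Fin 3 → Jet3) (σ : Equiv.Perm (Fin 3)), D (x ∘ σ) = D x)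
include hsym

/-- Symmetry: swap of the first two slots. -/
theorem tri_swap₁₂ (x y w : Jet3) : D ![x, y, w] = D ![y, x, w] := by
  rw [← hsym ![y, x, w] (Equiv.swap 0 1)]
  congr 1
  funext i; fin_cases i <;> rfl

/-- Symmetry: swap of the first and last slots. -/
theorem tri_swap₁₃ (x y w : Jet3) : D ![x, y, w] = D ![w, y, x] := by
  rw [← hsym ![w, y, x] (Equiv.swap 0 2)]
  congr 1
  funext i; fin_cases i <;> rfl

/-- Symmetry: swap of the last two slots. -/
theorem tri_swap₂₃ (x y w : Jet3) : D ![x, y, w] = D ![x, w, y] := by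
  rw [← hsym ![x, w, y] (Equiv.swap 1 2)]
  congr 1
  funext i; fin_cases i <;> rfl

/-- Additivity in the second slot. -/
theorem tri_add₂ (x y y' w : Jet3) : D ![x, y + y', w] = D ![x, y, w] + D ![x, y', w] := by
  rw [tri_swap₁₂ hsym x (y + y') w, tri_add₁, tri_swap₁₂ hsym y, tri_swap₁₂ hsym y']

/-- Additivity in the third slot. -/
theorem tri_add₃ (x y w w' : Jet3) : D ![x, y, w + w'] = D ![x, y, w] + D ![x, y, w'] := by
  rw [tri_swap₁₃ hsym x y (w + w'), tri_add₁, tri_swap₁₃ hsym w, tri_swap₁₃ hsym w']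

/-- Homogeneity in the second slot. -/
theorem tri_smul₂ (c : ℝ) (x y w : Jet3) : D ![x, c • y, w] = c * D ![x, y, w] := by
  rw [tri_swap₁₂ hsym x (c • y) w, tri_smul₁, tri_swap₁₂ hsym y]

/-- Homogeneity in the third slot. -/
theorem tri_smul₃ (c : ℝ) (x y w : Jet3) : D ![x, y, c • w] = c * D ![x, y, w] := by
  rw [tri_swap₁₃ hsym x y (c • w), tri_smul₁, tri_swap₁₃ hsym w]

/-- **Polarisation** of a symmetric trilinear form: `6 D(x, y, w)` in terms of diagonal values. -/
theorem tri_polar (x y w : Jet3) :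
    6 * D ![x, y, w] = D ![x + y + w, x + y + w, x + y + w] - D ![x + y, x + y, x + y]
      - D ![x + w, x + w, x + w] - D ![y + w, y + w, y + w] + D ![x, x, x] + D ![y, y, y] + D ![w, w, w] := by
  simp only [tri_add₁, tri_add₂ hsym, tri_add₃ hsym]
  linear_combination -(tri_swap₂₃ hsym x w y) - (tri_swap₁₂ hsym y x w)
    - (tri_swap₁₂ hsym y w x + tri_swap₁₃ hsym w y x) - (tri_swap₁₂ hsym w x y + tri_swap₂₃ hsym x w y)
    - (tri_swap₁₃ hsym w y x)

variable {k : ℕ} (hw : ∀ (s : ℝ), 0 < s → ∀ z : Jet3,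
  D (fun _ => ((z.1, s • z.2.1, (s ^ 2) • z.2.2.1, (s ^ 3) • z.2.2.2) : Jet3)) = s ^ k * D (fun _ => z))
include hw

/-- The **polarised weight identity** `D (S x, S y, S w) = s ^ k D (x, y, w)`, `S z = (z₀, s z₁, s² z₂, s³ z₃)`
the jet dilation. -/
theorem tri_weight_polar (s : ℝ) (hs : 0 < s) (x y w : Jet3) :
    D ![((x.1, s • x.2.1, (s ^ 2) • x.2.2.1, (s ^ 3) • x.2.2.2) : Jet3),
        ((y.1, s • y.2.1, (s ^ 2) • y.2.2.1, (s ^ 3) • y.2.2.2) : Jet3),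
        ((w.1, s • w.2.1, (s ^ 2) • w.2.2.1, (s ^ 3) • w.2.2.2) : Jet3)] = s ^ k * D ![x, y, w] := by
  have hwS : ∀ v : Jet3,
      D ![((v.1, s • v.2.1, (s ^ 2) • v.2.2.1, (s ^ 3) • v.2.2.2) : Jet3),
          ((v.1, s • v.2.1, (s ^ 2) • v.2.2.1, (s ^ 3) • v.2.2.2) : Jet3),
          ((v.1, s • v.2.1, (s ^ 2) • v.2.2.1, (s ^ 3) • v.2.2.2) : Jet3)] = s ^ k * D ![v, v, v] := by
    intro v
    rw [← const_eq_vec3, ← const_eq_vec3]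
    exact hw s hs v
  have hadd : ∀ a b : Jet3,
      (((a + b).1, s • (a + b).2.1, (s ^ 2) • (a + b).2.2.1, (s ^ 3) • (a + b).2.2.2) : Jet3) =
        ((a.1, s • a.2.1, (s ^ 2) • a.2.2.1, (s ^ 3) • a.2.2.2) : Jet3) +
          ((b.1, s • b.2.1, (s ^ 2) • b.2.2.1, (s ^ 3) • b.2.2.2) : Jet3) := by
    intro a b
    simp only [Prod.fst_add, Prod.snd_add, smul_add, Prod.mk_add_mk]
  have e := tri_polar hsym ((x.1, s • x.2.1, (s ^ 2) • x.2.2.1, (s ^ 3) • x.2.2.2) : Jet3)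
    ((y.1, s • y.2.1, (s ^ 2) • y.2.2.1, (s ^ 3) • y.2.2.2) : Jet3)
    ((w.1, s • w.2.1, (s ^ 2) • w.2.2.1, (s ^ 3) • w.2.2.2) : Jet3)
  simp only [← hadd, hwS] at e
  linear_combination (1 / 6 : ℝ) * e - (1 / 6 : ℝ) * s ^ k * tri_polar hsym x y w

variable (P : Fin 4 → Jet3) (hP : ∀ p : Fin 4,
  (((P p).1, (2 : ℝ) • (P p).2.1, ((2 : ℝ) ^ 2) • (P p).2.2.1, ((2 : ℝ) ^ 3) • (P p).2.2.2) : Jet3) =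
    (2 : ℝ) ^ (p : ℕ) • P p)
include hP

/-- **Vanishing of the wrong-weight blocks**: if each `P p` is dilated by `2 ^ p` (a pure jet of order `p`),
then `D (P p, P q, P r) = 0` unless `p + q + r = k` (compare the weights `2 ^ (p+q+r)` and `2 ^ k`). -/
theorem tri_pure_eq_zero (p q r : Fin 4) (hne : (p : ℕ) + q + r ≠ k) : D ![P p, P q, P r] = 0 := by
  have e := tri_weight_polar hsym hw 2 two_pos (P p) (P q) (P r)
  rw [hP, hP, hP, tri_smul₁, tri_smul₂ hsym, tri_smul₃ hsym, ← mul_assoc, ← mul_assoc, ← pow_add,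
    ← pow_add] at e
  have h2 : (2 : ℝ) ^ ((p : ℕ) + q + r) ≠ 2 ^ k :=
    fun h => hne (pow_right_injective₀ two_pos (by norm_num) h)
  have h0 : ((2 : ℝ) ^ ((p : ℕ) + q + r) - 2 ^ k) * D ![P p, P q, P r] = 0 := by
    rw [sub_mul, e, sub_self]
  rcases mul_eq_zero.1 h0 with h | h
  · exact absurd (sub_eq_zero.1 h) h2
  · exact h

/-- **Weight `3`**: on `z = ∑ₚ P p` the diagonal value is the sum of the blocks `(0,0,3) × 3`, `(0,1,2) × 6`,
`(1,1,1) × 1`. -/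
theorem tri_diag_weight_three (hk : k = 3) (z : Jet3) (hz : z = P 0 + P 1 + P 2 + P 3) :
    D ![z, z, z] = 3 * D ![P 0, P 0, P 3] + 6 * D ![P 0, P 1, P 2] + D ![P 1, P 1, P 1] := by
  subst hk
  have hv := tri_pure_eq_zero hsym hw P hP
  rw [hz]
  simp only [tri_add₁, tri_add₂ hsym, tri_add₃ hsym, hv _ _ _, ne_eq, not_false_eq_true, Fin.isValue,
    Fin.coe_ofNat_eq_mod, Nat.reduceMod, Nat.reduceAdd, Nat.reduceEqDiff, add_zero, zero_add]
  linear_combination tri_swap₁₃ hsym (P 3) (P 0) (P 0)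
    + (tri_swap₁₂ hsym (P 2) (P 0) (P 1) + tri_swap₂₃ hsym (P 0) (P 2) (P 1))
    + tri_swap₁₂ hsym (P 1) (P 0) (P 2) + tri_swap₁₃ hsym (P 2) (P 1) (P 0)
    + (tri_swap₁₂ hsym (P 1) (P 2) (P 0) + tri_swap₁₃ hsym (P 2) (P 1) (P 0))
    + tri_swap₂₃ hsym (P 0) (P 2) (P 1) + tri_swap₂₃ hsym (P 0) (P 3) (P 0)

/-- **Weight `5`**: on `z = ∑ₚ P p` the diagonal value is the sum of the blocks `(0,2,3) × 6`, `(1,1,3) × 3`,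
`(1,2,2) × 3`. -/
theorem tri_diag_weight_five (hk : k = 5) (z : Jet3) (hz : z = P 0 + P 1 + P 2 + P 3) :
    D ![z, z, z] = 6 * D ![P 0, P 2, P 3] + 3 * D ![P 1, P 1, P 3] + 3 * D ![P 1, P 2, P 2] := by
  subst hk
  have hv := tri_pure_eq_zero hsym hw P hP
  rw [hz]
  simp only [tri_add₁, tri_add₂ hsym, tri_add₃ hsym, hv _ _ _, ne_eq, not_false_eq_true, Fin.isValue,
    Fin.coe_ofNat_eq_mod, Nat.reduceMod, Nat.reduceAdd, Nat.reduceEqDiff, add_zero, zero_add]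
  linear_combination tri_swap₂₃ hsym (P 0) (P 3) (P 2) + tri_swap₁₂ hsym (P 2) (P 0) (P 3)
    + (tri_swap₁₃ hsym (P 2) (P 3) (P 0) + tri_swap₂₃ hsym (P 0) (P 3) (P 2))
    + (tri_swap₁₂ hsym (P 3) (P 0) (P 2) + tri_swap₂₃ hsym (P 0) (P 3) (P 2))
    + tri_swap₁₃ hsym (P 3) (P 2) (P 0) + tri_swap₂₃ hsym (P 1) (P 3) (P 1)
    + tri_swap₁₃ hsym (P 3) (P 1) (P 1) + tri_swap₁₂ hsym (P 2) (P 1) (P 2)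
    + tri_swap₁₃ hsym (P 2) (P 2) (P 1)

end Symmetric

/-- **Weight blocks of a symmetric trilinear form on 3-jets.** A continuous trilinear form `D` on 3-jets,
symmetric under permutations of its arguments and of weight `k` on the diagonal under the jet dilation
`(z₀, s z₁, s² z₂, s³ z₃)` (`s > 0`), equals on the diagonal the sum of its weight-`k` pure blocks: for
`k = 3` the blocks `(0,0,3) × 3`, `(0,1,2) × 6`, `(1,1,1) × 1`; for `k = 5` the blocks `(0,2,3) × 6`,
`(1,1,3) × 3`, `(1,2,2) × 3`. -/
theorem weight_blocks (k : ℕ) (D : Jet3 [×3]→L[ℝ] ℝ)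
    (hsym : ∀ (x : Fin 3 → Jet3) (σ : Equiv.Perm (Fin 3)), D (x ∘ σ) = D x)
    (hw : ∀ (s : ℝ), 0 < s → ∀ z : Jet3,
      D (fun _ => ((z.1, s • z.2.1, (s ^ 2) • z.2.2.1, (s ^ 3) • z.2.2.2) : Jet3)) = s ^ k * D (fun _ => z)) :
    (k = 3 → ∀ z : Jet3, D (fun _ => z) =
        3 * D ![((z.1, 0, 0, 0) : Jet3), ((z.1, 0, 0, 0) : Jet3), ((0, 0, 0, z.2.2.2) : Jet3)] +
        6 * D ![((z.1, 0, 0, 0) : Jet3), ((0, z.2.1, 0, 0) : Jet3), ((0, 0, z.2.2.1, 0) : Jet3)] +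
        D ![((0, z.2.1, 0, 0) : Jet3), ((0, z.2.1, 0, 0) : Jet3), ((0, z.2.1, 0, 0) : Jet3)]) ∧
     (k = 5 → ∀ z : Jet3, D (fun _ => z) =
        6 * D ![((z.1, 0, 0, 0) : Jet3), ((0, 0, z.2.2.1, 0) : Jet3), ((0, 0, 0, z.2.2.2) : Jet3)] +
        3 * D ![((0, z.2.1, 0, 0) : Jet3), ((0, z.2.1, 0, 0) : Jet3), ((0, 0, 0, z.2.2.2) : Jet3)] +
        3 * D ![((0, z.2.1, 0, 0) : Jet3), ((0, 0, z.2.2.1, 0) : Jet3), ((0, 0, z.2.2.1, 0) : Jet3)]) := by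
  refine ⟨fun hk z => ?_, fun hk z => ?_⟩
  · rw [const_eq_vec3]
    refine tri_diag_weight_three hsym hw
      ![((z.1, 0, 0, 0) : Jet3), (0, z.2.1, 0, 0), (0, 0, z.2.2.1, 0), (0, 0, 0, z.2.2.2)] ?_ hk z ?_
    · intro p
      fin_cases p <;> simp [smul_zero_cmm]
    · obtain ⟨a, b, c, d⟩ := z
      simp
  · rw [const_eq_vec3]
    refine tri_diag_weight_five hsym hw
      ![((z.1, 0, 0, 0) : Jet3), (0, z.2.1, 0, 0), (0, 0, z.2.2.1, 0), (0, 0, 0, z.2.2.2)] ?_ hk z ?_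
    · intro p
      fin_cases p <;> simp [smul_zero_cmm]
    · obtain ⟨a, b, c, d⟩ := z
      simp

end CubicJetExpansion

/-! ### The registered statement -/

/-- **stub `stub_cubicJetExpansion` of the crux `OddMorawetz.MorawetzKillsTypeI` (line `registered`).**
(i) Every continuous `n`-multilinear map `Z : ℝ³ × ⋯ × ℝ³ → ℝ³` is the finite combination of the basis maps
`h ↦ (∏ₛ h_s (j s)) eᵢ` with coefficients its values on basis vectors, `(Z (e_{j 0}, …, e_{j (n-1)}))ᵢ`.
(ii) A symmetric continuous trilinear form on 3-jets which scales with weight `k` under the jet dilation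
`(z₀, s z₁, s² z₂, s³ z₃)` (`s > 0`) is on the diagonal the sum of its weight-`k` blocks: for `k = 3` the
blocks `(0,0,3)`, `(0,1,2)`, `(1,1,1)` with multiplicities `3, 6, 1`, for `k = 5` the blocks `(0,2,3)`,
`(1,1,3)`, `(1,2,2)` with `6, 3, 3`. -/
theorem stub_cubicJetExpansion :
    (∀ (n : ℕ) (Z : E3 [×n]→L[ℝ] E3),
      Z = ∑ i : Fin 3, ∑ j : Fin n → Fin 3,
        (Z (fun s => EuclideanSpace.single (j s) (1 : ℝ)) i) •
          (ContinuousMultilinearMap.mkPiRing ℝ (Fin n) (EuclideanSpace.single i (1 : ℝ))).compContinuousLinearMap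
            (fun s => EuclideanSpace.proj (j s))) ∧
    (∀ (k : ℕ) (D : Jet3 [×3]→L[ℝ] ℝ),
      (∀ (x : Fin 3 → Jet3) (σ : Equiv.Perm (Fin 3)), D (x ∘ σ) = D x) →
      (∀ (s : ℝ), 0 < s → ∀ z : Jet3,
        D (fun _ => ((z.1, s • z.2.1, (s ^ 2) • z.2.2.1, (s ^ 3) • z.2.2.2) : Jet3)) = s ^ k * D (fun _ => z)) →
      ((k = 3 → ∀ z : Jet3, D (fun _ => z) =
          3 * D ![((z.1, 0, 0, 0) : Jet3), ((z.1, 0, 0, 0) : Jet3), ((0, 0, 0, z.2.2.2) : Jet3)] +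
          6 * D ![((z.1, 0, 0, 0) : Jet3), ((0, z.2.1, 0, 0) : Jet3), ((0, 0, z.2.2.1, 0) : Jet3)] +
          D ![((0, z.2.1, 0, 0) : Jet3), ((0, z.2.1, 0, 0) : Jet3), ((0, z.2.1, 0, 0) : Jet3)]) ∧
       (k = 5 → ∀ z : Jet3, D (fun _ => z) =
          6 * D ![((z.1, 0, 0, 0) : Jet3), ((0, 0, z.2.2.1, 0) : Jet3), ((0, 0, 0, z.2.2.2) : Jet3)] +
          3 * D ![((0, z.2.1, 0, 0) : Jet3), ((0, z.2.1, 0, 0) : Jet3), ((0, 0, 0, z.2.2.2) : Jet3)] +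
          3 * D ![((0, z.2.1, 0, 0) : Jet3), ((0, 0, z.2.2.1, 0) : Jet3), ((0, 0, z.2.2.1, 0) : Jet3)]))) :=
  ⟨CubicJetExpansion.coordinate_expansion, CubicJetExpansion.weight_blocks⟩

end Summit.NavierStokesRegularity.NavierStokesRegularity.Theorems
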